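import Summits.BirchSwinnertonDyer.Rank1Residual.P2.PrintCf2SplitBadTwoReadTwoCut
import HarnessLib

set_option autoImplicit false

/-!
# READ₂ cut, road B′: «THE SEAM MODULO LEVEL n» — the weakest sufficient (= necessary) form of the junction (γ′) ⊕ (δ) of
# R219-INST₂-CORE (glue algebra on `(ℤ/N)ˣ`, Mathlib-only over P47's `RamifiedReading`), and the index model of (δ)
# (`Γ = (ℤ/2^{n+1})ˣ`, `γ₀ = 1 + 2^n`)

Cell `bsd-print-cf2`, discharge-interface typer `bsd-print-cf2-ty2` g46 (literature-prover seat; Summits-side helpers in the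
typer's directory `Rank1Residual/P2/`, Theses-free, no item): port **P62 (part 1 of 3: PART M §A + §B)** of STUB-PLAN
`stub_heegnerIndexLowerAtTwo` v8.1 (crux `PrintCf2.SplitBadTwoLowerHalfOfFacts`, stmt-BirchSwinnertonDyer-27851; `CRITIC-ROWS-g46.md`
row 132 = **R227 «THE SEAM MODULO LEVEL n»**; sketch k1-g43 `c394c15f3c926eba` PART M §A (ll. 1278–1414) and §B (ll. 1416–1483),
VERBATIM up to the namespace and the `open` of the tree's P47 `ReadTwoCut.{RamifiedReading, …}` in place of the sketch's verbatim
copy).  Parts 2/3: `evS_map_reflE` (Literature `LubinTateComparisonTraceTransportRelTwo.lean`) and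
`PrintCf2SplitBadTwoDeltaRead.lean` (PART M §C–§E: `readingValue_eq_half_sub`, ★★ `delta_read₂`, `delta_charSum`, the typed (γ′)).
HONEST FRAMING: B′ construction-road plumbing below the receptacle (weight 0); nothing here proves BSD, the crux, the stub or
HARDEST (a)/(b); no named fact, no `sorry`; the one `def` (`shiftUnit`, data) is the unit `1 + 2^n ∈ (ℤ/2^{n+1})ˣ`.

* §A glue (over `ReadTwoCut.RamifiedReading`, the REFL presentation `V₁ = V − c`, `V₂ = −c` of `read₂_of_refl_cut`):
  A1 `ramifiedReading_const_iff` · A2 ★ `read₂_of_unit_identity` (READ₂ from ONE identity per unit class `V(eγ) = κ·D γ + c`,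
  `D γ = T γ − T(γγ₀)`) · A3 ★ `read₂_of_refl_cut_of_diffSeam` (the seam `hS2` weakened to the `γ₀`-DIFFERENCE identity) · A4 ★★
  `read₂_of_refl_cut_of_seam_mod_periodic` (`Lg(eγ) = T γ + C γ` for ANY `γ₀`-periodic `C`) · A5 `read₂_of_refl_cut'` (P47's lemma
  is the case `C = 0`) · A6 ★ `diffSeam_of_read₂` (NECESSITY, `κ` cancellable) · A7/A7′ `reflTable_add_periodic`,
  `reflTable_eq_iff_periodic` (the freedom left in the seam is EXACTLY the `γ₀`-periodic tables) · A8 `sum_mul_periodic_eq_zero`,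
  `sum_mul_add_periodic` (periodic tables are invisible to every `ψ` with `ψ(γγ₀) = −ψ γ` — the invisibility statement OF RECORD
  is stub-ideation k2-g37 §5 `coset_sum_correction_invisible` / `sum_antiperiodic_mul_periodic_eq_zero` (STUB-PLAN row 109, K50),
  here in multiplicative-table dress; credit k2-g37) · A9 ★ `exists_periodic_iff_diffSeam` (seam-mod-periodic = difference seam).
* §B the index model of (δ): `coprime_one_add_two_pow`, `shiftUnit n hn = 1 + 2^n`, `coe_shiftUnit`, `two_pow_succ_eq_zero`,
  `two_pow_mul_two_pow_eq_zero`, `shiftUnit_mul_self` (`γ₀² = 1`), `unit_mul_two_pow`, ★ `coe_mul_shiftUnit` (`γ·γ₀ = γ + 2^n` =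
  the `hshift` of `read₂_of_refl_cut`), ★ `periodic_of_level` (tables pulled back from level `n` are `γ₀`-periodic; the converse
  — `1 + 2^n` generates `ker((ℤ/2^{n+1})ˣ → (ℤ/2^n)ˣ)` — is not needed by the consumer and not proved here, critic price (iii)).

References: stub-critic `CRITIC-ROWS-g46.md` row 132 (R227), `STUB-PLAN-stub_heegnerIndexLowerAtTwo.md` §3 (lvii); [deShalit1987]
I.3.3 (7)–(8) (p. 17) for the reflection `z ↦ −2 − z` behind the REFL presentation.
-/

noncomputable section

namespace Summit.BirchSwinnertonDyer.Rank1Residual.P2.SeamModLevel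

/-! ### §A  Glue algebra (Mathlib-only, PROVED).  READ₂'s REFL conclusion is ONE identity per unit class; the seam
`hS2` of `read₂_of_refl_cut` is needed only as a DIFFERENCE identity, i.e. modulo `γ₀`-periodic tables; conversely the
unit identity forces the difference seam (so this is the weakest sufficient AND the strongest necessary form). -/
section Glue

open ReadTwoCut (RamifiedReading UnitReading ramifiedReading_of_unitReading unitReading_of_ramifiedReading)

variable {R' : Type*} [CommRing R'] {N : ℕ}

/-- A1. With `V₁ = V − c`, `V₂ = −c` (the REFL presentation of record) `RamifiedReading` IS the unit identity
`V(eγ) − c = ℓ γ` — conjunct 1 is an algebraic tautology. -/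
theorem ramifiedReading_const_iff {M : ℕ} (hMN : M ∣ N) {Γ : Type*} (e : Γ ≃ (ZMod N)ˣ)
    (V : ZMod N → R') (c : R') (ℓ : Γ → R') :
    RamifiedReading hMN V (fun j : ZMod N => V j + -c) (fun _ : ZMod M => -c) e ℓ ↔
      ∀ γ : Γ, V (e γ : ZMod N) + -c = ℓ γ :=
  ⟨fun h γ => h.2 γ, fun h => ⟨fun j => show V j = V j + -c - -c by ring, h⟩⟩

/-- A2 ★ **THE WEAKEST SUFFICIENT FORM of (γ′) ⊕ (δ)**: READ₂ (REFL shape) from ONE identity per unit class,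
split as (δ) `V(eγ) = κ·D γ + c` (the reading value is `κ` times SOME difference datum `D` plus the gauge constant)
and (γ′) `D γ = T γ − T(γ·γ₀)` (the datum is the `γ₀`-difference of the table `T`).  No `Lg`, no shift `s`, no
hypothesis off the units. -/
theorem read₂_of_unit_identity {M : ℕ} (hMN : M ∣ N) {Γ : Type*} [Mul Γ] (e : Γ ≃ (ZMod N)ˣ)
    (V : ZMod N → R') (D T : Γ → R') (κ c : R') (γ₀ : Γ)
    (hS1 : ∀ γ : Γ, V (e γ : ZMod N) = κ * D γ + c)
    (hS2 : ∀ γ : Γ, D γ = T γ - T (γ * γ₀)) :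
    RamifiedReading hMN V (fun j : ZMod N => V j + -c) (fun _ : ZMod M => -c) e
      (fun γ => κ * (T γ - T (γ * γ₀))) :=
  (ramifiedReading_const_iff hMN e V c _).mpr fun γ => by rw [hS1, hS2]; ring

/-- A3 ★ **DIFFERENCE SEAM**: `ReadTwoCut.read₂_of_refl_cut` (P47) with (i) `hS1` asked ON UNITS ONLY and (ii) the seam
`hS2` weakened to the `γ₀`-DIFFERENCE identity `Lg(eγ) − Lg(e(γγ₀)) = T γ − T(γγ₀)`. -/
theorem read₂_of_refl_cut_of_diffSeam {M : ℕ} (hMN : M ∣ N) {Γ : Type*} [Mul Γ] (e : Γ ≃ (ZMod N)ˣ)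
    (V Lg : ZMod N → R') (T : Γ → R') (κ c : R') (s : ZMod N) (γ₀ : Γ)
    (hshift : ∀ γ : Γ, ((e (γ * γ₀) : (ZMod N)ˣ) : ZMod N) = (e γ : ZMod N) + s)
    (hS1 : ∀ γ : Γ, V (e γ : ZMod N) = κ * (Lg (e γ : ZMod N) - Lg ((e γ : ZMod N) + s)) + c)
    (hS2 : ∀ γ : Γ, Lg (e γ : ZMod N) - Lg (e (γ * γ₀) : ZMod N) = T γ - T (γ * γ₀)) :
    RamifiedReading hMN V (fun j : ZMod N => V j + -c) (fun _ : ZMod M => -c) e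
      (fun γ => κ * (T γ - T (γ * γ₀))) :=
  read₂_of_unit_identity hMN e V (fun γ => Lg (e γ : ZMod N) - Lg (e (γ * γ₀) : ZMod N)) T κ c γ₀
    (fun γ => by rw [hS1, ← hshift]) hS2

/-- A4 ★★ **THE SEAM MODULO `γ₀`-PERIODIC TABLES** (the form (γ′) actually has to deliver): `Lg(eγ) = T γ + C γ` with
ANY `γ₀`-periodic correction `C` (`C(γγ₀) = C γ`) gives the SAME `RamifiedReading` as the exact seam. With
`γ₀ = 1 + 2^n` (§B) the periodic tables are exactly the tables pulled back from `(ℤ/2^n)ˣ` — additive constants,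
per-level constants, anything normalised at level `n`. -/
theorem read₂_of_refl_cut_of_seam_mod_periodic {M : ℕ} (hMN : M ∣ N) {Γ : Type*} [Mul Γ] (e : Γ ≃ (ZMod N)ˣ)
    (V Lg : ZMod N → R') (T : Γ → R') (κ c : R') (s : ZMod N) (γ₀ : Γ) (C : Γ → R')
    (hC : ∀ γ : Γ, C (γ * γ₀) = C γ)
    (hshift : ∀ γ : Γ, ((e (γ * γ₀) : (ZMod N)ˣ) : ZMod N) = (e γ : ZMod N) + s)
    (hS1 : ∀ γ : Γ, V (e γ : ZMod N) = κ * (Lg (e γ : ZMod N) - Lg ((e γ : ZMod N) + s)) + c)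
    (hS2 : ∀ γ : Γ, Lg (e γ : ZMod N) = T γ + C γ) :
    RamifiedReading hMN V (fun j : ZMod N => V j + -c) (fun _ : ZMod M => -c) e
      (fun γ => κ * (T γ - T (γ * γ₀))) :=
  read₂_of_refl_cut_of_diffSeam hMN e V Lg T κ c s γ₀ hshift hS1 fun γ => by rw [hS2, hS2, hC]; ring

/-- A5. `ReadTwoCut.read₂_of_refl_cut` (P47) is the special case `C = 0`, `hS1` everywhere (sanity: nothing lost). -/
theorem read₂_of_refl_cut' {M : ℕ} (hMN : M ∣ N) {Γ : Type*} [Mul Γ] (e : Γ ≃ (ZMod N)ˣ)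
    (V Lg : ZMod N → R') (T : Γ → R') (κ c : R') (s : ZMod N) (γ₀ : Γ)
    (hshift : ∀ γ : Γ, ((e (γ * γ₀) : (ZMod N)ˣ) : ZMod N) = (e γ : ZMod N) + s)
    (hS1 : ∀ a : ZMod N, V a = κ * (Lg a - Lg (a + s)) + c)
    (hS2 : ∀ γ : Γ, Lg (e γ : ZMod N) = T γ) :
    RamifiedReading hMN V (fun j : ZMod N => V j + -c) (fun _ : ZMod M => -c) e
      (fun γ => κ * (T γ - T (γ * γ₀))) :=
  read₂_of_refl_cut_of_diffSeam hMN e V Lg T κ c s γ₀ hshift (fun γ => hS1 _) fun γ => by rw [hS2, hS2]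

/-- A6 ★ **NECESSITY** (strongest necessary = weakest sufficient): if `κ` is cancellable, the REFL reading with table
`κ·(T γ − T(γγ₀))` FORCES the difference seam.  So (γ′) cannot be weakened below A3/A4. -/
theorem diffSeam_of_read₂ {M : ℕ} (hMN : M ∣ N) {Γ : Type*} [Mul Γ] (e : Γ ≃ (ZMod N)ˣ)
    (V Lg : ZMod N → R') (T : Γ → R') {κ : R'} (hκ : IsUnit κ) (c : R') (s : ZMod N) (γ₀ : Γ)
    (hshift : ∀ γ : Γ, ((e (γ * γ₀) : (ZMod N)ˣ) : ZMod N) = (e γ : ZMod N) + s)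
    (hS1 : ∀ γ : Γ, V (e γ : ZMod N) = κ * (Lg (e γ : ZMod N) - Lg ((e γ : ZMod N) + s)) + c)
    (h : RamifiedReading hMN V (fun j : ZMod N => V j + -c) (fun _ : ZMod M => -c) e
      (fun γ => κ * (T γ - T (γ * γ₀)))) :
    ∀ γ : Γ, Lg (e γ : ZMod N) - Lg (e (γ * γ₀) : ZMod N) = T γ - T (γ * γ₀) := by
  intro γ
  have h1 : V (e γ : ZMod N) + -c = κ * (T γ - T (γ * γ₀)) := h.2 γ
  rw [hS1, ← hshift] at h1
  exact hκ.mul_left_cancel (by linear_combination h1)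

/-- A7. The REFL table sees `T` only modulo `γ₀`-periodic tables … -/
theorem reflTable_add_periodic {Γ : Type*} [Mul Γ] (T C : Γ → R') (κ : R') (γ₀ : Γ)
    (hC : ∀ γ : Γ, C (γ * γ₀) = C γ) :
    (fun γ => κ * ((T γ + C γ) - (T (γ * γ₀) + C (γ * γ₀)))) = fun γ => κ * (T γ - T (γ * γ₀)) := by
  funext γ; rw [hC]; ring

/-- A7′ … and EXACTLY modulo them: two tables give the same REFL table iff they differ by a `γ₀`-periodic table
(`κ` cancellable).  This is the precise freedom left in the seam (γ′). -/
theorem reflTable_eq_iff_periodic {Γ : Type*} [Mul Γ] (T T' : Γ → R') {κ : R'} (hκ : IsUnit κ) (γ₀ : Γ) :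
    ((fun γ => κ * (T γ - T (γ * γ₀))) = fun γ => κ * (T' γ - T' (γ * γ₀))) ↔
      ∀ γ : Γ, T (γ * γ₀) - T' (γ * γ₀) = T γ - T' γ := by
  rw [funext_iff]
  refine forall_congr' fun γ => ⟨fun h => ?_, fun h => ?_⟩
  · have h' := hκ.mul_left_cancel h
    linear_combination -h'
  · congr 1; linear_combination -h

/-- A8 ★ **PERIODIC TABLES ARE INVISIBLE to the characters the consumer uses** (`ψ(γγ₀) = −ψ γ`, i.e. `ψ(γ₀) = −1`
for a multiplicative `ψ`; `2` a non-zero-divisor — the sketch's hypothesis `γ₀² = 1` is not needed): `Σ_γ ψ(γ)·C(γ) = 0`.  The invisibility statement OF RECORD is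
stub-ideation k2-g37 §5 (`sum_antiperiodic_mul_periodic_eq_zero` / `coset_sum_correction_invisible`, STUB-PLAN row 109, K50),
there in additive dress on `ℤ/2^{n+1}`; this is its multiplicative-table form on `Γ` (credit: k2-g37). -/
theorem sum_mul_periodic_eq_zero {Γ : Type*} [Group Γ] [Fintype Γ] [NoZeroDivisors R'] (h2 : (2 : R') ≠ 0)
    (ψ C : Γ → R') (γ₀ : Γ)
    (hψ : ∀ γ : Γ, ψ (γ * γ₀) = -ψ γ) (hC : ∀ γ : Γ, C (γ * γ₀) = C γ) :
    ∑ γ : Γ, ψ γ * C γ = 0 := by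
  have hre : ∑ γ : Γ, ψ (γ * γ₀) * C (γ * γ₀) = ∑ γ : Γ, ψ γ * C γ :=
    Fintype.sum_equiv (Equiv.mulRight γ₀) _ _ fun _ => rfl
  simp_rw [hψ, hC, neg_mul, Finset.sum_neg_distrib] at hre
  have h2S : (2 : R') * ∑ γ : Γ, ψ γ * C γ = 0 := by linear_combination -hre
  exact (mul_eq_zero.mp h2S).resolve_left h2

/-- A8′. Hence the consumer's character sum of `T + C` is that of `T`. -/
theorem sum_mul_add_periodic {Γ : Type*} [Group Γ] [Fintype Γ] [NoZeroDivisors R'] (h2 : (2 : R') ≠ 0)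
    (ψ T C : Γ → R') (γ₀ : Γ)
    (hψ : ∀ γ : Γ, ψ (γ * γ₀) = -ψ γ) (hC : ∀ γ : Γ, C (γ * γ₀) = C γ) :
    ∑ γ : Γ, ψ γ * (T γ + C γ) = ∑ γ : Γ, ψ γ * T γ := by
  simp_rw [mul_add, Finset.sum_add_distrib, sum_mul_periodic_eq_zero h2 ψ C γ₀ hψ hC, add_zero]

/-- A9 ★ **SEAM-MOD-PERIODIC = DIFFERENCE SEAM** (additive groups): `L = T + C` for SOME `γ₀`-periodic `C` iff
`L(γ) − L(γγ₀) = T(γ) − T(γγ₀)` for all `γ` — so A3 and A4 are the same weakening, and by A6 it is sharp. -/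
theorem exists_periodic_iff_diffSeam {A : Type*} [AddCommGroup A] {Γ : Type*} [Mul Γ] (L T : Γ → A) (γ₀ : Γ) :
    (∃ C : Γ → A, (∀ γ, C (γ * γ₀) = C γ) ∧ ∀ γ, L γ = T γ + C γ) ↔
      ∀ γ : Γ, L γ - L (γ * γ₀) = T γ - T (γ * γ₀) := by
  constructor
  · rintro ⟨C, hC, hL⟩ γ
    rw [hL, hL, hC]; abel
  · intro h
    refine ⟨fun γ => L γ - T γ, fun γ => ?_, fun γ => (add_sub_cancel (T γ) (L γ)).symm⟩
    have := h γ
    simp only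
    rw [sub_eq_sub_iff_sub_eq_sub] at this
    rw [← this]

/-- Degenerate instance (vacuity check, B68): constant `V`, `T = 0`, `D = 0` satisfy A2 with `ℓ = 0`. -/
example {M : ℕ} (hMN : M ∣ N) {Γ : Type*} [Mul Γ] (e : Γ ≃ (ZMod N)ˣ) (c κ : R') (γ₀ : Γ) :
    RamifiedReading hMN (fun _ : ZMod N => c) (fun _ : ZMod N => c + -c) (fun _ : ZMod M => -c) e
      (fun γ => κ * ((0 : Γ → R') γ - (0 : Γ → R') (γ * γ₀))) :=
  read₂_of_unit_identity hMN e (fun _ => c) 0 0 κ c γ₀ (fun _ => by simp) (fun _ => by simp)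

end Glue

/-! ### §B  The index model of (δ) (Mathlib-only, PROVED): `Γ = (ℤ/2^{n+1})ˣ`, `e = refl`, `γ₀ = 1 + 2^n` (`n ≥ 1`),
`γ·γ₀ = γ + 2^n`, `γ₀² = 1`; `γ₀`-periodic = pulled back from level `n`. -/
section Index

/-- `1 + 2^n` is prime to `2^{n+1}` (`n ≥ 1`). -/
theorem coprime_one_add_two_pow (n : ℕ) (hn : 1 ≤ n) : Nat.Coprime (1 + 2 ^ n) (2 ^ (n + 1)) := by
  have hodd : Odd (1 + 2 ^ n) := by
    obtain ⟨k, rfl⟩ := Nat.exists_eq_add_of_le hn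
    exact ⟨2 ^ k, by ring⟩
  exact (Nat.coprime_two_right.mpr hodd).pow_right (n + 1)

/-- `γ₀ := 1 + 2^n ∈ (ℤ/2^{n+1})ˣ` (`n ≥ 1`) — the index shift `a ↦ a + 2^n` (`ζ^{a+2^n} = −ζ^a`) as a unit. -/
def shiftUnit (n : ℕ) (hn : 1 ≤ n) : (ZMod (2 ^ (n + 1)))ˣ :=
  ZMod.unitOfCoprime (1 + 2 ^ n) (coprime_one_add_two_pow n hn)

/-- `(γ₀ : ℤ/2^{n+1}) = 1 + 2^n`. -/
theorem coe_shiftUnit (n : ℕ) (hn : 1 ≤ n) : (shiftUnit n hn : ZMod (2 ^ (n + 1))) = 1 + 2 ^ n := by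
  rw [shiftUnit, ZMod.coe_unitOfCoprime, Nat.cast_add, Nat.cast_one, Nat.cast_pow, Nat.cast_ofNat]

/-- `2^{n+1} = 0` in `ℤ/2^{n+1}`. -/
theorem two_pow_succ_eq_zero (n : ℕ) : (2 : ZMod (2 ^ (n + 1))) ^ (n + 1) = 0 := by
  have h := ZMod.natCast_self (2 ^ (n + 1))
  push_cast at h
  exact h

/-- `2^n · 2^n = 0` in `ℤ/2^{n+1}` (`n ≥ 1`). -/
theorem two_pow_mul_two_pow_eq_zero (n : ℕ) (hn : 1 ≤ n) : (2 : ZMod (2 ^ (n + 1))) ^ n * 2 ^ n = 0 := by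
  rw [← pow_add]
  exact pow_eq_zero_of_le (by omega) (two_pow_succ_eq_zero n)

/-- `γ₀² = 1`. -/
theorem shiftUnit_mul_self (n : ℕ) (hn : 1 ≤ n) : shiftUnit n hn * shiftUnit n hn = 1 := by
  apply Units.ext
  rw [Units.val_mul, coe_shiftUnit, Units.val_one]
  linear_combination two_pow_mul_two_pow_eq_zero n hn + two_pow_succ_eq_zero n

/-- Units are odd: `γ · 2^n = 2^n` in `ℤ/2^{n+1}`. -/
theorem unit_mul_two_pow (n : ℕ) (γ : (ZMod (2 ^ (n + 1)))ˣ) :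
    (γ : ZMod (2 ^ (n + 1))) * 2 ^ n = 2 ^ n := by
  have hcop := ZMod.val_coe_unit_coprime γ
  have hodd : Odd (γ : ZMod (2 ^ (n + 1))).val :=
    Nat.coprime_two_right.mp (Nat.Coprime.coprime_dvd_right ⟨2 ^ n, by ring⟩ hcop)
  obtain ⟨k, hk⟩ := hodd
  have hmul : (γ : ZMod (2 ^ (n + 1))) * 2 ^ n =
      (k : ZMod (2 ^ (n + 1))) * ((2 : ZMod (2 ^ (n + 1))) ^ n * 2) + 2 ^ n := by
    conv_lhs => rw [← ZMod.natCast_zmod_val (γ : ZMod (2 ^ (n + 1))), hk]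
    push_cast
    ring
  rw [hmul, ← pow_succ, two_pow_succ_eq_zero, mul_zero, zero_add]

/-- ★ `hshift` of `read₂_of_refl_cut` in the index model: `γ·γ₀ = γ + 2^n`. -/
theorem coe_mul_shiftUnit (n : ℕ) (hn : 1 ≤ n) (γ : (ZMod (2 ^ (n + 1)))ˣ) :
    ((γ * shiftUnit n hn : (ZMod (2 ^ (n + 1)))ˣ) : ZMod (2 ^ (n + 1))) = (γ : ZMod (2 ^ (n + 1))) + 2 ^ n := by
  rw [Units.val_mul, coe_shiftUnit, mul_add, mul_one, unit_mul_two_pow n γ]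

/-- ★ `γ₀`-PERIODIC = LEVEL `n`: every table pulled back along `ℤ/2^{n+1} → ℤ/2^n` is `γ₀`-periodic. -/
theorem periodic_of_level (n : ℕ) (hn : 1 ≤ n) {R' : Type*} (C' : ZMod (2 ^ n) → R') (γ : (ZMod (2 ^ (n + 1)))ˣ) :
    C' (ZMod.castHom (pow_dvd_pow 2 (Nat.le_succ n)) (ZMod (2 ^ n)) ((γ * shiftUnit n hn : (ZMod (2 ^ (n + 1)))ˣ) :
      ZMod (2 ^ (n + 1)))) =
      C' (ZMod.castHom (pow_dvd_pow 2 (Nat.le_succ n)) (ZMod (2 ^ n)) (γ : ZMod (2 ^ (n + 1)))) := by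
  congr 1
  rw [coe_mul_shiftUnit, map_add, map_pow, map_ofNat]
  have h := ZMod.natCast_self (2 ^ n)
  push_cast at h
  rw [h, add_zero]

/-- Finite-level sanity (B68): `n = 1, 2`. -/
example : ∀ u : ZMod 8, IsUnit u → u * 4 = 4 := by decide
example : ((1 + 4 : ZMod 8)) * (1 + 4) = 1 := by decide
example : ∀ u : ZMod 4, IsUnit u → u * (1 + 2) = u + 2 := by decide

end Index

end Summit.BirchSwinnertonDyer.Rank1Residual.P2.SeamModLevel

end
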